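import Literature.NumberTheory.EllipticCurves.HeegnerPointsTrustBaseProofs
import Literature.NumberTheory.EllipticCurves.HeegnerPointsSingularModuliField
import Literature.NumberTheory.EllipticCurves.ComplexMultiplicationClassPolynomialIrreducibleProofs
import HarnessLib

/-!
# `exists_isHeegnerPoint` from Modularity, the Manin constant and Darmon's Theorems 3.6–3.7

A `…Proofs` companion (theorems only: no definitions, no named facts, no instances) of
`Literature/NumberTheory/EllipticCurves/HeegnerPoints.lean`, for the named fact
`Literature.NumberTheory.EllipticCurves.exists_isHeegnerPoint W K` (Gross–Zagier 1986, I.§4;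
Gross 1991, §1: for a globally minimal elliptic `W/ℚ` of conductor `N_E` and an imaginary
quadratic field `K` in which every `p ∣ N_E` splits, some `P ∈ E(K)` is a Heegner point of level
`N_E`), continuing `HeegnerPointsTrustBaseProofs.lean`.

State of the reduction in the tree before this file. `HeegnerPointsTrustBaseProofs.lean` brought
the hypothesis set of the fact down to the Modularity theorem `exists_isNewformOf` (BCDT 2001,
Thm. A (2); proved *necessary*: `exists_isNewformOf_of_forall_exists_isHeegnerPoint`), the
rational Manin constant `IsNewformOf.exists_maninConstant_ne_zero`, and the complex-multiplication
fact `heegnerPoints_galoisConj N_E W K` (the points `φ(τ_Q)` come from a `Gal(L/K)`-permuted family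
over a finite Galois `L/K`). `HeegnerPointsSingularModuliField.lean` then reduced the CM fact
(`heegnerPoints_galoisConj_of_singularModuliField`) to three inputs over the concrete field of
singular moduli `H_K = ι(K)(j(τ_Q) : Q reduced of discriminant d_K) ⊂ ℂ`: the named fact
`irreducible_classPolynomial` (`H_D ∈ ℚ[X]` irreducible, Cox Prop. 13.2 — making `H_K/K` finite
Galois) and, as inline hypotheses, Darmon's **Thm. 3.6** (PDF pp. 43–44: "`Φ_N(τ)` belongs to
`E(H)`" — each `φ(τ_Q)`, `Q` a Heegner form of level `N` and discriminant `d_K`, is the image of a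
point of `E(H_K)`) and **Thm. 3.7** (PDF p. 44, Shimura reciprocity "`Φ_N(α ⋆ τ) = rec(α⁻¹) Φ_N(τ)`",
with Gross 1984 §I.1: `Gal(H_K/K)` permutes the family `(φ(τ_Q))_{Q ∈ reps}` of a Heegner datum).
Since then `irreducible_classPolynomial` has been **proved** in the tree
(`irreducible_classPolynomial_holds`, `ComplexMultiplicationClassPolynomialIrreducibleProofs.lean`,
along Deuring's algebraic route: all singular moduli of discriminant `D` are conjugate, `j`
separates reduced forms, and Cox Thm. 10.23).

This file records the consequence for `exists_isHeegnerPoint` (all PROVED, by composition):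

* `heegnerPoints_galoisConj_of_darmon` — Darmon Thm. 3.6 and Thm. 3.7 over `H_K` (inline, exactly
  the hypotheses `h36`, `h37` of `heegnerPoints_galoisConj_of_singularModuliField`) give the CM fact
  `heegnerPoints_galoisConj N W K`, now unconditionally in the class polynomial; hence
  (`heegnerPointComplex_mem_range_map_of_darmon`) leaf 4 `heegnerPointComplex_mem_range_map N W K`
  of `HeegnerPointsRationality.lean` (descent of the trace, Darmon §3.7, proved in
  `HeegnerPointsGaloisDescent.lean`).
* `exists_isHeegnerPoint_of_modularity_of_maninConstant_of_darmon` — **the current hypothesis set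
  of the fact**: `exists_isNewformOf` (Modularity, BCDT Thm. A (2)),
  `IsNewformOf.exists_maninConstant_ne_zero` (rational Manin constant) and Darmon's Thms. 3.6, 3.7
  at level `N_E` over `H_K` give `exists_isHeegnerPoint W K`. Of these, the first is necessary
  (`exists_isNewformOf_of_forall_exists_isHeegnerPoint`), the first two together are necessary
  (`nonempty_modularParametrizationData_of_forall_exists_isHeegnerPoint`), and the last two are the
  two printed theorems whose proofs need the model of `X₀(N)` over `ℚ`, the `ℚ`-rationality of the
  modular parametrisation and the Artin map of `H_K/K` — none of which is in Mathlib (pin v4.32.0).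
* `forall_exists_isHeegnerPoint_iff_of_darmon` — granted Darmon's Thms. 3.6–3.7 over `H_K` at
  every level, `(∀ W K, exists_isHeegnerPoint W K) ↔ exists_isNewformOf ∧
  IsNewformOf.exists_maninConstant_ne_zero`: modulo these two printed CM theorems the fact is
  *equivalent* to the Modularity leaf `nonempty_modularParametrizationData`
  (`forall_exists_isHeegnerPoint_iff_nonempty_modularParametrizationData_of_darmon`).

Nothing is weakened (the conclusions are literally `exists_isHeegnerPoint W K`, the converse
consumes literally `exists_isHeegnerPoint`), nothing is restated, and no definition or named fact
is introduced (D-0026): the two printed theorems stay inline hypotheses, verbatim those of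
`heegnerPoints_galoisConj_of_singularModuliField`.

## References

* H. Darmon, *Rational Points on Modular Elliptic Curves*, CBMS Regional Conference Series in
  Mathematics 101, AMS (2004) (held: `paper:doi-10-1090-cbms-101`): Thm. 3.5 and Thm. 3.6
  (PDF p. 43), Thm. 3.7 (PDF p. 44), Hypothesis 3.9 (PDF p. 45), §3.7 (PDF p. 49:
  "`P_K = Trace_{H_1/K}(P_1) ∈ E(K)`"). [Darmon2004]
* B. H. Gross, *Kolyvagin's work on modular elliptic curves*, in *`L`-functions and arithmetic*
  (Durham, 1989), LMS Lecture Note Ser. 153 (1991), 235–256, §1 (held volume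
  `book:editornd-l-functions-arithmetic`, PDF pp. 212–213: "`x₁` is rational over `K₁` …
  `y_K = Tr_{K₁/K}(y₁)` in `E(K)`"). [GrossLMS1991]
* B. H. Gross, D. B. Zagier, *Heegner points and derivatives of `L`-series*, Invent. Math. 84
  (1986), 225–320, I.§3–§4. [GrossZagier1986]
* D. A. Cox, *Primes of the form x² + ny²*, 2nd ed., Wiley (2013), §13.A Prop. 13.2, Cor. 11.34.
  [Cox2013]
* C. Breuil, B. Conrad, F. Diamond, R. Taylor, *On the modularity of elliptic curves over `ℚ`*,
  J. Amer. Math. Soc. 14 (2001), 843–939, Thm. A; p. 845, (2) and (6). [BCDTJAMS2001]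
-/

noncomputable section

open scoped Classical

open Literature.NumberTheory.EllipticCurves.ModularForms NumberField
  Literature.NumberTheory.QuadraticFields.BinaryQuadraticForm
  Literature.NumberTheory.QuadraticFields.Quadratic

universe u

namespace Literature.NumberTheory.EllipticCurves

/-! ### The CM fact and leaf 4 from Darmon's Theorems 3.6 and 3.7, at a general level `N` -/

section Level

variable {N : ℕ} [NeZero N] {W : WeierstrassCurve ℚ} {K : Type u} [Field K] [NumberField K]

/-- **The CM fact `heegnerPoints_galoisConj N W K` from Darmon's Thm. 3.6 and Thm. 3.7 over the
field of singular moduli `H_K ⊂ ℂ`** — `heegnerPoints_galoisConj_of_singularModuliField` with its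
class-polynomial input discharged by the tree's theorem `irreducible_classPolynomial_holds`
(Cox Prop. 13.2: `H_{d_K} ∈ ℚ[X]` irreducible, whence `H_K/K` is finite Galois). The two remaining
hypotheses are verbatim those of that theorem: `h36` — Darmon 2004, Thm. 3.6 ("Let `τ` be any
element in `ℍ ∩ K` … Then `Φ_N(τ)` belongs to `E(H)`"), for the Heegner forms of level `N` and
discriminant `d_K` (for which `H = H_K`) and the parametrisation `φ = Dt.φ` of any datum `Dt`;
`h37` — Darmon 2004, Thm. 3.7 ("`Φ_N(α ⋆ τ) = rec(α⁻¹) Φ_N(τ)`") in the form used by the descent: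
under the Heegner hypothesis every `σ ∈ Gal(H_K/K)` permutes any family of `H_K`-rational preimages
of the `φ(τ_q)`, `q ∈ reps` of a Heegner datum (Gross 1984, §I.1: the classes with fixed `𝔫` form
one `Pic(𝒪_K)`-orbit). [cite: Darmon2004, Thm. 3.6 and Thm. 3.7 (PDF pp. 43–44)] -/
theorem heegnerPoints_galoisConj_of_darmon
    (h36 : ∀ [W.IsElliptic] (_ : IsImaginaryQuadratic K) (Dt : ModularParametrizationData W N)
      (ι : K →+* ℂ) {Q : ℤ × ℤ × ℤ} (_ : Q ∈ heegnerForms N (NumberField.discr K)),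
      ∃ P : (W.baseChange (singularModuliField K ι)).toAffine.Point,
        WeierstrassCurve.Affine.Point.map (singularModuliField K ι).subtype.toRatAlgHom P =
          Dt.φ (heegnerTau Q))
    (h37 : ∀ [W.IsElliptic] (_ : IsImaginaryQuadratic K) (_ : SatisfiesHeegnerHypothesis N K)
      (Dt : ModularParametrizationData W N) (H : HeegnerDatum N (NumberField.discr K))
      (ι : K →+* ℂ) (P : H.reps → (W.baseChange (singularModuliField K ι)).toAffine.Point)
      (_ : ∀ q : H.reps,
        WeierstrassCurve.Affine.Point.map (singularModuliField K ι).subtype.toRatAlgHom (P q) =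
          Dt.φ (heegnerTau q))
      (σ : singularModuliField K ι ≃ₐ[K] singularModuliField K ι),
      ∃ e : Equiv.Perm H.reps, ∀ q : H.reps,
        WeierstrassCurve.Affine.Point.map
          (σ : singularModuliField K ι →ₐ[K] singularModuliField K ι) (P q) = P (e q)) :
    heegnerPoints_galoisConj N W K :=
  heegnerPoints_galoisConj_of_singularModuliField irreducible_classPolynomial_holds h36 h37

/-- **Leaf 4 of `exists_isHeegnerPoint` from Darmon's Thm. 3.6 and Thm. 3.7 over `H_K`**: the
traced Heegner point `∑_{[Q]} φ(τ_Q) ∈ E(ℂ)` of every datum is the image of a point of `E(K)`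
(`heegnerPointComplex_mem_range_map N W K`), by `heegnerPoints_galoisConj_of_darmon` and the
proved Galois descent of the trace (`heegnerPointComplex_mem_range_map_of_galoisConj`; Darmon
2004, §3.7: "`P_K = Trace_{H_1/K}(P_1) ∈ E(K)`"; Gross 1991, §1: "`y_K = Tr_{K₁/K}(y₁)` in
`E(K)`"). [cite: Darmon2004, §3.7 (PDF p. 49), with Thm. 3.6 and Thm. 3.7]
[cite: GrossLMS1991, §1 (pp. 235–236)] -/
theorem heegnerPointComplex_mem_range_map_of_darmon
    (h36 : ∀ [W.IsElliptic] (_ : IsImaginaryQuadratic K) (Dt : ModularParametrizationData W N)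
      (ι : K →+* ℂ) {Q : ℤ × ℤ × ℤ} (_ : Q ∈ heegnerForms N (NumberField.discr K)),
      ∃ P : (W.baseChange (singularModuliField K ι)).toAffine.Point,
        WeierstrassCurve.Affine.Point.map (singularModuliField K ι).subtype.toRatAlgHom P =
          Dt.φ (heegnerTau Q))
    (h37 : ∀ [W.IsElliptic] (_ : IsImaginaryQuadratic K) (_ : SatisfiesHeegnerHypothesis N K)
      (Dt : ModularParametrizationData W N) (H : HeegnerDatum N (NumberField.discr K))
      (ι : K →+* ℂ) (P : H.reps → (W.baseChange (singularModuliField K ι)).toAffine.Point)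
      (_ : ∀ q : H.reps,
        WeierstrassCurve.Affine.Point.map (singularModuliField K ι).subtype.toRatAlgHom (P q) =
          Dt.φ (heegnerTau q))
      (σ : singularModuliField K ι ≃ₐ[K] singularModuliField K ι),
      ∃ e : Equiv.Perm H.reps, ∀ q : H.reps,
        WeierstrassCurve.Affine.Point.map
          (σ : singularModuliField K ι →ₐ[K] singularModuliField K ι) (P q) = P (e q)) :
    heegnerPointComplex_mem_range_map N W K :=
  heegnerPointComplex_mem_range_map_of_galoisConj (heegnerPoints_galoisConj_of_darmon h36 h37)

end Level

/-! ### The fact at level `N_E`: Modularity, the Manin constant, Darmon's Theorems 3.6–3.7 -/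

section Conductor

variable (W : WeierstrassCurve ℚ) (K : Type u) [Field K] [NumberField K]

/-- **`exists_isHeegnerPoint` from the Modularity theorem, the rational Manin constant and
Darmon's Theorems 3.6–3.7** — the current hypothesis set of the fact. For `W/ℚ` a globally minimal
elliptic curve of conductor `N_E` and `K` an imaginary quadratic field satisfying the Heegner
hypothesis for `N_E`, some `P ∈ E(K)` is a Heegner point of level `N_E` (`exists_isHeegnerPoint W K`;
Gross–Zagier 1986, I.§4; Gross 1991, §1), granted: `exists_isNewformOf` (BCDT 2001, Thm. A (2)),
`IsNewformOf.exists_maninConstant_ne_zero` (together exactly the Modularity leaf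
`nonempty_modularParametrizationData`, and together necessary:
`nonempty_modularParametrizationData_of_forall_exists_isHeegnerPoint`), and, at level `N_E` over
the field of singular moduli `H_K`, Darmon's Thm. 3.6 (`h36`: every `φ(τ_Q)` comes from `E(H_K)`)
and Thm. 3.7 (`h37`: `Gal(H_K/K)` permutes the `φ(τ_q)` of a Heegner datum). Compared with
`exists_isHeegnerPoint_of_modularity_of_maninConstant_of_galoisConj`, the CM named fact
`heegnerPoints_galoisConj` is replaced by these two printed theorems, the class-field part
(`irreducible_classPolynomial`) being a theorem of the tree.
[cite: GrossZagier1986, I.§4] [cite: GrossLMS1991, §1 (pp. 235–236)]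
[cite: Darmon2004, Thm. 3.6 and Thm. 3.7 (PDF pp. 43–44), §3.7 (PDF p. 49)] -/
theorem exists_isHeegnerPoint_of_modularity_of_maninConstant_of_darmon
    (h₁ : exists_isNewformOf) (ha : IsNewformOf.exists_maninConstant_ne_zero)
    (h36 : ∀ [NeZero (W.conductorNorm ℤ)] [W.IsElliptic] (_ : IsImaginaryQuadratic K)
      (Dt : ModularParametrizationData W (W.conductorNorm ℤ)) (ι : K →+* ℂ) {Q : ℤ × ℤ × ℤ}
      (_ : Q ∈ heegnerForms (W.conductorNorm ℤ) (NumberField.discr K)),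
      ∃ P : (W.baseChange (singularModuliField K ι)).toAffine.Point,
        WeierstrassCurve.Affine.Point.map (singularModuliField K ι).subtype.toRatAlgHom P =
          Dt.φ (heegnerTau Q))
    (h37 : ∀ [NeZero (W.conductorNorm ℤ)] [W.IsElliptic] (_ : IsImaginaryQuadratic K)
      (_ : SatisfiesHeegnerHypothesis (W.conductorNorm ℤ) K)
      (Dt : ModularParametrizationData W (W.conductorNorm ℤ))
      (H : HeegnerDatum (W.conductorNorm ℤ) (NumberField.discr K)) (ι : K →+* ℂ)
      (P : H.reps → (W.baseChange (singularModuliField K ι)).toAffine.Point)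
      (_ : ∀ q : H.reps,
        WeierstrassCurve.Affine.Point.map (singularModuliField K ι).subtype.toRatAlgHom (P q) =
          Dt.φ (heegnerTau q))
      (σ : singularModuliField K ι ≃ₐ[K] singularModuliField K ι),
      ∃ e : Equiv.Perm H.reps, ∀ q : H.reps,
        WeierstrassCurve.Affine.Point.map
          (σ : singularModuliField K ι →ₐ[K] singularModuliField K ι) (P q) = P (e q)) :
    exists_isHeegnerPoint W K :=
  exists_isHeegnerPoint_of_modularity_of_maninConstant_of_galoisConj W K h₁ ha
    (heegnerPoints_galoisConj_of_darmon h36 h37)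

/-- **Modulo Darmon's Theorems 3.6–3.7 over `H_K`, the fact is equivalent to the Modularity
leaf.** Granted Thm. 3.6 and Thm. 3.7 over the field of singular moduli at every level `N ≥ 1`
(inline, as in `heegnerPoints_galoisConj_of_darmon`), the statement "`exists_isHeegnerPoint W K`
for every `W/ℚ` and every number field `K`" is equivalent to
`exists_isNewformOf ∧ IsNewformOf.exists_maninConstant_ne_zero`: ⇒ unconditionally
(`nonempty_modularParametrizationData_of_forall_exists_isHeegnerPoint`), ⇐ by
`exists_isHeegnerPoint_of_modularity_of_maninConstant_of_darmon`
(through `forall_exists_isHeegnerPoint_iff_of_galoisConj`). [folklore] -/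
theorem forall_exists_isHeegnerPoint_iff_of_darmon
    (h36 : ∀ (N : ℕ) [NeZero N] (W : WeierstrassCurve ℚ) (K : Type) [Field K] [NumberField K]
      [W.IsElliptic] (_ : IsImaginaryQuadratic K) (Dt : ModularParametrizationData W N)
      (ι : K →+* ℂ) {Q : ℤ × ℤ × ℤ} (_ : Q ∈ heegnerForms N (NumberField.discr K)),
      ∃ P : (W.baseChange (singularModuliField K ι)).toAffine.Point,
        WeierstrassCurve.Affine.Point.map (singularModuliField K ι).subtype.toRatAlgHom P =
          Dt.φ (heegnerTau Q))
    (h37 : ∀ (N : ℕ) [NeZero N] (W : WeierstrassCurve ℚ) (K : Type) [Field K] [NumberField K]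
      [W.IsElliptic] (_ : IsImaginaryQuadratic K) (_ : SatisfiesHeegnerHypothesis N K)
      (Dt : ModularParametrizationData W N) (H : HeegnerDatum N (NumberField.discr K))
      (ι : K →+* ℂ) (P : H.reps → (W.baseChange (singularModuliField K ι)).toAffine.Point)
      (_ : ∀ q : H.reps,
        WeierstrassCurve.Affine.Point.map (singularModuliField K ι).subtype.toRatAlgHom (P q) =
          Dt.φ (heegnerTau q))
      (σ : singularModuliField K ι ≃ₐ[K] singularModuliField K ι),
      ∃ e : Equiv.Perm H.reps, ∀ q : H.reps,
        WeierstrassCurve.Affine.Point.map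
          (σ : singularModuliField K ι →ₐ[K] singularModuliField K ι) (P q) = P (e q)) :
    (∀ (W : WeierstrassCurve ℚ) (K : Type) [Field K] [NumberField K], exists_isHeegnerPoint W K) ↔
      exists_isNewformOf ∧ IsNewformOf.exists_maninConstant_ne_zero :=
  forall_exists_isHeegnerPoint_iff_of_galoisConj
    fun N _ W K _ _ ↦ heegnerPoints_galoisConj_of_darmon (h36 N W K) (h37 N W K)

/-- The same equivalence with the Modularity leaf on the right: granted Darmon's Thms. 3.6–3.7
over `H_K` at every level, `(∀ W K, exists_isHeegnerPoint W K) ↔ nonempty_modularParametrizationData`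
(through `forall_exists_isHeegnerPoint_iff_nonempty_modularParametrizationData_of_galoisConj`).
[folklore] -/
theorem forall_exists_isHeegnerPoint_iff_nonempty_modularParametrizationData_of_darmon
    (h36 : ∀ (N : ℕ) [NeZero N] (W : WeierstrassCurve ℚ) (K : Type) [Field K] [NumberField K]
      [W.IsElliptic] (_ : IsImaginaryQuadratic K) (Dt : ModularParametrizationData W N)
      (ι : K →+* ℂ) {Q : ℤ × ℤ × ℤ} (_ : Q ∈ heegnerForms N (NumberField.discr K)),
      ∃ P : (W.baseChange (singularModuliField K ι)).toAffine.Point,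
        WeierstrassCurve.Affine.Point.map (singularModuliField K ι).subtype.toRatAlgHom P =
          Dt.φ (heegnerTau Q))
    (h37 : ∀ (N : ℕ) [NeZero N] (W : WeierstrassCurve ℚ) (K : Type) [Field K] [NumberField K]
      [W.IsElliptic] (_ : IsImaginaryQuadratic K) (_ : SatisfiesHeegnerHypothesis N K)
      (Dt : ModularParametrizationData W N) (H : HeegnerDatum N (NumberField.discr K))
      (ι : K →+* ℂ) (P : H.reps → (W.baseChange (singularModuliField K ι)).toAffine.Point)
      (_ : ∀ q : H.reps,
        WeierstrassCurve.Affine.Point.map (singularModuliField K ι).subtype.toRatAlgHom (P q) =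
          Dt.φ (heegnerTau q))
      (σ : singularModuliField K ι ≃ₐ[K] singularModuliField K ι),
      ∃ e : Equiv.Perm H.reps, ∀ q : H.reps,
        WeierstrassCurve.Affine.Point.map
          (σ : singularModuliField K ι →ₐ[K] singularModuliField K ι) (P q) = P (e q)) :
    (∀ (W : WeierstrassCurve ℚ) (K : Type) [Field K] [NumberField K], exists_isHeegnerPoint W K) ↔
      nonempty_modularParametrizationData :=
  forall_exists_isHeegnerPoint_iff_nonempty_modularParametrizationData_of_galoisConj
    fun N _ W K _ _ ↦ heegnerPoints_galoisConj_of_darmon (h36 N W K) (h37 N W K)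

end Conductor

end Literature.NumberTheory.EllipticCurves

end
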